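import Literature.Claims.NS.Chae2007
import Literature.Claims.NS.ClayR3LocalEnergyBridge
import HarnessLib

/-!
# Claim skeleton C157 `Zeroual2026` — Islem Zeroual, «Global Regularity of 3D Incompressible
# Navier-Stokes Equations: A Complete Proof via Orlicz-Zygmund Spectral Stability and Natural Damping
# Frequency» (Zenodo record 19374469, concept 19374468, 2026-04-01; printed «April 1, 2026»; 12 pp.)

Cell `ns-claims` (D-0090 NS-CLAIMS SWEEP), claim C157 (RULINGS v1.37, tail tranche 4a row A20), typist
`ns-claims-typist-4` (g5); refuter of record `ns-claims-refuter-4` (g5), second `ns-claims-refuter-3` (g4);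
referee lane 2; salvage `ns-claims-salvage-p4`. UNREFEREED / DISPUTED CLAIM under adjudication — **nothing
in this file asserts a step**: the claimed statement and every step are `Prop`-valued definitions; the
`theorem`s are the kernel COMPOSITION of the paper's own chain, the Clay link, and bookkeeping.

TEXT OF RECORD: census staging `pub/ns-claims/ns-claims-census-1/tranche2-staging/Zeroual2026/
zenodo-19374469.pdf` (README.txt dea9ddf7ae96e53c; census pin `census/texts/Zeroual2026/` by the SOURCED
lane ns-claims-lit-1 g9), PDF sha16 67ed76c3a8cda1df, 12 pp.; PDF page = file `pages/pNNN.txt`, whose line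
numbers are cited below (the printed page number is the footer «Page N» = PDF page); LOCATORS.md v1 (ns-claims-lit-1
g9). Bib key `Zeroual2026` (doi 10.5281/zenodo.19374469). ONE text of record: the later records of the same title
under a NEW concept (V2 = 19475967, V3 = 19484026) and the companion record 19514768 are recorded in LOCATORS §0 and
are not typed here.

## What the text contains (checked on the pages)

§1 p.4: (1.1)–(1.3) unforced Navier–Stokes on `ℝ³`, `ν > 0`, «u₀ ∈ H¹(ℝ³)»; Def 1.1 (smooth solution);
Thm 1.2 (Leray), Thm 1.3 (BKM); **Theorem 1.4 (Global Regularity) p.4 l.50–62** = the claim. §2 p.5: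
Def 2.1 `H, V, D(A)` («A = −PΔ is the Stokes operator»), Remark 2.2, **Def 2.3 (2.5) the Orlicz–Zygmund
functional `‖f‖²_{L² log L} = ∫|f|² log(e + |f|/‖f‖_{L²}) dx`**, **Def 2.4 (2.6) `C*_L := inf_{u ∈ D(A),
u ≢ 0} ‖Au‖²_{L²}/‖u‖²_{L² log L}`**, Remark 2.5 (dimensions), Def 2.6 (2.11) `Ω_L := ν √C*_L`. §3 p.6–7:
Lemmas 3.1 (concentration-compactness), 3.2 (dichotomy exclusion), 3.3 (equi-integrability) — the
printed proof of Thm 4.1. **§4 p.7 l.10–42 Theorem 4.1 (Main Lemma) (4.1) `C*_L > 0`, «independent of the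
solution u»**; Remarks 4.2, 4.3 ((4.2) `C*_L ≥ λ₁/C²_BGW`). §5 p.8–9 «Proof of Theorem 1.4»: Step 1 (5.1)
`dE/dt + ν‖Au‖² ≤ |⟨(u·∇)u, Au⟩|`, `E = ½‖ω‖²_{L²}`; Step 2 (5.2) «modified Brezis–Gallouet–Wainger»
`‖∇u‖_∞ ≤ C_BGW Ω_L √(log(e + ‖Au‖_{L²}/(Ω_L‖u‖_{L²})))`, (5.3)–(5.4); Step 3 (5.5)–(5.6)
**`dE/dt ≤ C′E log(e + E)`**, Remark 5.1 (5.7) `C′ = C_BGW · Ω_L`; Remark 5.2; Step 4 (5.8)–(5.9) Osgood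
`E(t) ≤ F(T, E₀) < ∞ ∀ t ∈ [0,T]`; Step 5 (5.10)–(5.11) BGW for `ω` and BKM. §6 p.10 Thm 6.1 (blow-up
exclusion, by (5.6) + Osgood). §7 p.10 Thm 7.1 (scaling «λ³ = λ³»). §8 p.11 conclusion; refs p.11–12.

## How it is typed

* Data: Thm 1.4 «any initial data u₀ ∈ H¹(ℝ³) with ∇·u₀ = 0» with the conclusion `u ∈ C^∞([0,∞) × ℝ³)`;
  the abstract p.2 l.29–32 («All solutions with smooth divergence-free initial data in H¹(ℝ³) remain
  smooth») and §1.2 fix the smooth reading: `IsDatum u₀` = smooth ∧ divergence-free ∧ `InH1 u₀`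
  (`u₀, Du₀ ∈ L²`, classical derivative) — charitable (the non-smooth H¹ reading makes (1.5) false at
  `t = 0` for trivial reasons), disclosed.
* Solutions: the tree's classical (jointly `C^∞`) unforced solutions with `u(0) = u₀` on a time set `S`
  (`IsSolutionOn`); `E(t) = ½‖ω(t)‖²_{L²}` is `Ens u t` (real; finiteness asserted where displayed).
* `D(A)` (2.3) at the classical grain: `InDA u` = `C²` ∧ divergence-free ∧ `u, Δu ∈ L²`; `‖Au‖_{L²}` is
  rendered as `‖Δu‖_{L²}` (`A = −PΔ` and `PΔu = Δu` on divergence-free `H²` fields — classical; the sign is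
  immaterial inside the norm). Typing `D(A)` through `C²` fields is a SUB-class of the printed `H² ∩ {div
  = 0}`: an infimum over the printed class is at most the infimum over the sub-class, so (4.1) typed over
  the sub-class is implied by the print (charitable, disclosed).
* The constants: `K : Constants` carries `C*_L` (Def 2.4), `C_BGW > 0` ([3,4], «depends only on d = 3»,
  Remark 5.1) and the unnamed `C` of (5.4); `Ω_L = ν√C*_L` (2.11) and `C′ = C_BGW Ω_L` (5.7) are
  DEFINED from them (`OmegaL`, `Cprime`). One `K` for all data and solutions (pattern C102/C143/C152);
  a kill is `∀ K, ¬ Step_k K`.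
* (1.5) prints `u ∈ L^∞([0,∞); H¹)`; the printed proof delivers bounds on every `[0,T]` ((5.8) «E(t) ≤
  F(T,E₀) < ∞ ∀ t ∈ [0,T]», Thm 6.1) and the theorem adds «Moreover, E(t) < ∞ for all t ∈ [0,∞)»: the
  claim is typed at the grain its proof addresses — global smooth solution with `‖u(t)‖_{H¹}` bounded on
  every `[0,T]` (`ClaimedTheorem`); the uniform-in-time reading is recorded as `ClaimedTheoremUniform`
  (not consumed; it implies `ClaimedTheorem`, `claimed_of_uniform`). Charitable, disclosed.

## Clay delta (reference `Literature.Claims.NS.ClayVariants`, axes of its §3)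

Direction REGULARITY (POS); nearest Clay statement (A) = `ClayVariants.clayR3.Regularity`. Δ1 `ℝ³` = ·
Δ2 (1.1)–(1.2) unforced, `ν > 0` = · Δ3 none = · **Δ4 data smooth ∩ H¹, divergence-free ⊋ Clay (4) — the
printed statement is STRONGER than (A) on data; the inclusion (4) ⊂ H¹ is carried as the explicit
hypothesis `ClayDelta`** · Δ5 conclusion: smooth on `[0,∞) × ℝ³` (= (6) with the smooth pressure of the
classical rendering), `H¹`-bounded on compacts, «unique» extra (typed separately); Fefferman's (7)
(energy BOUNDED) is not in Thm 1.4 (Def 1.1 (4) asks only `∫|u(t)|² < ∞`) — supplied by the energy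
inequality the text cites as Thm 1.2 (Leray), binder `Step_Energy` of the Clay link · Δ6 `C*_L, C_BGW, C′`
· Δ7 `ν > 0` arbitrary = . `clay_of_claimed : ClaimedTheorem → Step_Energy → ClayDelta → clayR3.Regularity`
PROVED.

## Step index (print order; argument order of `claim_of_steps`)

* Step 0 = `Step0_LWP` — local theory + blow-up alternative in `H¹` (Thm 6.1 p.10 l.8–11 «Assume there
  exists T* < ∞ such that E(t) → ∞ as t → T*»; §5 Step 5 p.9 l.44–58) — implicit/classical; consumed.
* Step 1 = `Step1_Thm41 K` — Thm 4.1 (4.1) p.7 with Def 2.4 (2.6) p.5: `C*_L`, a lower bound of the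
  quotient over `D(A)`, is positive — consumed (through `C′ > 0`).
* Step 2 = `Step2_Eq51` — (5.1) p.8 l.12–21 — support (`_`).
* Step 3 = `Step3_BGW52 K` — (5.2) p.8 l.22–35 — support (`_`).
* Step 4 = `Step4_Eq54 K` — (5.3)–(5.4) p.8 l.36–40 — support (`_`).
* Step 5 = `Step5_Law56 K` — (5.5)–(5.6) p.8 l.41–52 with (5.7): the enstrophy law along solutions —
  LOAD-BEARING, consumed.
* Step 6 = `Step6_Osgood` — (5.8)–(5.9) p.9 l.16–28 / (6.3) p.10: Osgood bound at the function grain —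
  consumed (TRUE-type real analysis).
* Step 7 = `Step7_BGW510` — (5.10)–(5.11) p.9 l.44–57 — support (`_`; the composition runs through the
  Thm 6.1 dichotomy instead).
* Lemmas 3.1–3.3 p.6–7, Remarks 4.2–4.3, 5.1–5.3, Thm 7.1: recorded in docstrings, not typed as Props
  (the printed proof of Thm 4.1; convergence modes of Lemma 3.1 (3) unspecified; Thm 7.1 is dimensional
  bookkeeping «λ³ = λ³»).

WHAT THIS IS NOT: not a claim about NS regularity or blow-up; not a claim about any author beyond the typed
locator.
-/

open scoped ContDiff ENNReal NNReal Topology Laplacian InnerProductSpace RealInnerProductSpace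
open _root_.MeasureTheory _root_.Set _root_.Filter

namespace Literature.Claims.NS.Zeroual2026

open Literature.Analysis.FluidPDE

noncomputable section

/-- `ℝ³` (plumbing abbreviation). [folklore] -/
abbrev E3 : Type := EuclideanSpace ℝ (Fin 3)

/-! ## A. Norms, data, solutions, constants -/

/-- `‖f‖²_{L²(ℝ³)}` as a real number (`0` when infinite; finiteness is asserted where the print displays
the norm as a number). [cite: Zeroual2026, Def 2.1 (2.1) p.5 l.4–11] -/
def l2Sq {F : Type*} [NormedAddCommGroup F] (f : E3 → F) : ℝ := (∫⁻ x, ‖f x‖ₑ ^ 2).toReal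

/-- `‖f‖_{L²(ℝ³)}`. [cite: Zeroual2026, Def 2.1 (2.1) p.5 l.4–11] -/
def l2 {F : Type*} [NormedAddCommGroup F] (f : E3 → F) : ℝ := Real.sqrt (l2Sq f)

/-- **The Orlicz–Zygmund functional (2.5) p.5 l.32–48**: «‖f‖²_{L² log L} = ∫_{ℝ³} |f|² log(e +
|f|/‖f‖_{L²}) dx» (Young function `Φ(t) = t² log(e + t)`), as a Bochner integral (`0` when not
integrable). [cite: Zeroual2026, Def 2.3 (2.5) p.5 l.32–48] -/
def olSq (f : E3 → E3) : ℝ := ∫ x, ‖f x‖ ^ 2 * Real.log (Real.exp 1 + ‖f x‖ / l2 f)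

/-- **`D(A)` (2.3) p.5 l.19–26 at the classical grain**: `u ∈ C²`, divergence-free, `u ∈ L²`, `Δu ∈ L²`
(a sub-class of the printed `{u ∈ H²(ℝ³)³ : ∇·u = 0}`; see the module docstring).
[cite: Zeroual2026, Def 2.1 (2.3) p.5 l.19–26] -/
def InDA (u : E3 → E3) : Prop :=
  ContDiff ℝ 2 u ∧ VectorCalculus.IsDivFree u ∧ (∫⁻ x, ‖u x‖ₑ ^ 2) < ⊤ ∧ (∫⁻ x, ‖(Δ u) x‖ₑ ^ 2) < ⊤

/-- `‖Au‖²_{L²}` for `u ∈ D(A)`, `A = −PΔ` the Stokes operator (p.5 l.26): on divergence-free fields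
`PΔu = Δu`, so the square norm is `‖Δu‖²_{L²}`. [cite: Zeroual2026, Def 2.1 p.5 l.19–31] -/
def stokesSq (u : E3 → E3) : ℝ := l2Sq (Δ u)

/-- The printed constants: `C*_L` (Def 2.4 (2.6) p.5 — the text's «optimal embedding constant»; Thm 4.1
asserts its positivity), `C_BGW > 0` (the Brezis–Gallouet–Wainger constant, «depends only on the spatial
dimension d = 3», Remark 5.1 p.8 l.69–71) and the unnamed `C` of (5.4) p.8 l.38–40. Carried as
parameters; nothing about them is asserted here. [cite: Zeroual2026, Def 2.4 p.5 l.49–65; Remark 5.1 p.8 l.53–71] -/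
structure Constants where
  /-- `C*_L` of (2.6). -/
  Cstar : ℝ
  /-- `C_BGW` of (4.2), (5.2), (5.7). -/
  CBGW : ℝ
  /-- the constant `C` of (5.4). -/
  C54 : ℝ
  /-- «C_BGW … > 0» ((4.2) p.8 l.2–10; a constant of an embedding inequality). -/
  CBGW_pos : 0 < CBGW

/-- **The natural damping frequency (2.11) p.5 l.107–116**: `Ω_L := ν √C*_L`.
[cite: Zeroual2026, Def 2.6 (2.11) p.5 l.107–116] -/
def OmegaL (K : Constants) (ν : ℝ) : ℝ := ν * Real.sqrt K.Cstar

/-- **The constant `C′` of (5.6), by (5.7) p.8 l.53–68**: `C′ = C_BGW · Ω_L = C_BGW · ν √C*_L`.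
[cite: Zeroual2026, Remark 5.1 (5.7) p.8 l.53–68] -/
def Cprime (K : Constants) (ν : ℝ) : ℝ := K.CBGW * OmegaL K ν

/-- `u₀ ∈ H¹(ℝ³)` for a (classically differentiable) field: `u₀ ∈ L²` and `Du₀ ∈ L²`.
[cite: Zeroual2026, (1.3) p.4 l.9–13; Def 2.1 (2.2) p.5 l.12–18] -/
def InH1 (u₀ : E3 → E3) : Prop :=
  (∫⁻ x, ‖u₀ x‖ₑ ^ 2) < ⊤ ∧ (∫⁻ x, ‖fderiv ℝ u₀ x‖ₑ ^ 2) < ⊤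

/-- `‖u₀‖²_{H¹} = ‖u₀‖²_{L²} + ‖Du₀‖²_{L²}` as a real number. [cite: Zeroual2026, Def 2.1 (2.2) p.5 l.12–18] -/
def h1Sq (u₀ : E3 → E3) : ℝ := l2Sq u₀ + l2Sq (fderiv ℝ u₀)

/-- The printed data class (Thm 1.4 p.4 l.51–53 with the abstract p.2 l.29–32 and §1.2 p.4 l.17–20):
smooth, divergence-free, `u₀ ∈ H¹(ℝ³)`. [cite: Zeroual2026, Thm 1.4 p.4 l.50–62; abstract p.2 l.29–32] -/
def IsDatum (u₀ : E3 → E3) : Prop :=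
  ContDiff ℝ ∞ u₀ ∧ VectorCalculus.IsDivFree u₀ ∧ InH1 u₀

/-- A solution of (1.1)–(1.3) on the time set `S` (`[0,T)` or `[0,∞)`) from `u₀`: the tree's classical
unforced solution with viscosity `ν` (jointly smooth `u`, `p`) and `u(0) = u₀` (Def 1.1 p.4 l.21–35 items
1–3, 5). [cite: Zeroual2026, (1.1)–(1.3) p.4 l.3–14; Def 1.1 p.4 l.21–35] -/
structure IsSolutionOn (ν : ℝ) (S : Set ℝ) (u₀ : E3 → E3) (u : ℝ → E3 → E3) (p : ℝ → E3 → ℝ) :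
    Prop where
  /-- (1.1)–(1.2) hold classically on `ℝ³ × S`, `u`, `p` jointly smooth. -/
  isClassical : IsClassicalNSSolutionOn S ν 0 u p
  /-- (1.3): `u(·,0) = u₀`. -/
  initial : u 0 = u₀

/-- **Enstrophy `E(t) = ½‖ω(t)‖²_{L²}`** (§5 Step 1 p.8 l.13–17), `ω = ∇ × u` (p.4 l.49), as a real number.
[cite: Zeroual2026, §5 Step 1 p.8 l.12–17] -/
def Ens (u : ℝ → E3 → E3) (t : ℝ) : ℝ := 1 / 2 * l2Sq (curl (u t))

/-! ## B. The claimed statement -/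

/-- **CLAIMED THEOREM = Theorem 1.4 (Global Regularity) p.4 l.50–62**: «For any initial data u₀ ∈ H¹(R³)
with ∇·u₀ = 0, there exists a unique global smooth solution: u ∈ C^∞([0,∞) × R³)³ ∩ L^∞([0,∞); H¹(R³))³
(1.5). Moreover, E(t) < ∞ for all t ∈ [0,∞).» Typed for every `ν > 0` ((1.1) p.4 l.14) and every datum
of the class: a global classical solution from `u₀` whose `H¹` norm is finite and bounded on every
`[0,T]` and whose enstrophy is finite at every time — the grain the printed proof addresses ((5.8),
Thm 6.1; module docstring «How it is typed»); the uniform-in-time reading of (1.5) is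
`ClaimedTheoremUniform`, «unique» is `ClaimedUniqueness`. [claim: Zeroual2026, status: disputed]
[cite: Zeroual2026, Thm 1.4 p.4 l.50–62] -/
def ClaimedTheorem : Prop :=
  ∀ ν : ℝ, 0 < ν → ∀ u₀ : E3 → E3, IsDatum u₀ →
    ∃ (u : ℝ → E3 → E3) (p : ℝ → E3 → ℝ), IsSolutionOn ν (Ici 0) u₀ u p ∧
      (∀ T : ℝ, 0 < T → ∃ M : ℝ, ∀ t ∈ Icc 0 T, InH1 (u t) ∧ h1Sq (u t) ≤ M) ∧
      ∀ t : ℝ, 0 ≤ t → (∫⁻ x, ‖curl (u t) x‖ₑ ^ 2) < ⊤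

/-- (1.5) read uniformly in time: `u ∈ L^∞([0,∞); H¹)` with one bound for all `t ≥ 0`. Recorded; not
consumed by the chain (whose (5.8) is a bound on each `[0,T]`); it implies `ClaimedTheorem`
(`claimed_of_uniform`). [claim: Zeroual2026, status: disputed] [cite: Zeroual2026, Thm 1.4 (1.5) p.4 l.55–61] -/
def ClaimedTheoremUniform : Prop :=
  ∀ ν : ℝ, 0 < ν → ∀ u₀ : E3 → E3, IsDatum u₀ →
    ∃ (u : ℝ → E3 → E3) (p : ℝ → E3 → ℝ), IsSolutionOn ν (Ici 0) u₀ u p ∧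
      (∃ M : ℝ, ∀ t : ℝ, 0 ≤ t → InH1 (u t) ∧ h1Sq (u t) ≤ M) ∧
      ∀ t : ℝ, 0 ≤ t → (∫⁻ x, ‖curl (u t) x‖ₑ ^ 2) < ⊤

/-- The word «unique» of Thm 1.4 p.4 l.54, AS PRINTED for global smooth solutions from a datum of the
class (no decay class on `u` is printed). Not argued in the text, not consumed by the chain; typist's
note: at this grain (no spatial decay imposed on `u`, `p`) classical non-uniqueness families exist —
recorded, not keyed. [claim: Zeroual2026, status: disputed] [cite: Zeroual2026, Thm 1.4 p.4 l.54] -/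
def ClaimedUniqueness : Prop :=
  ∀ ν : ℝ, 0 < ν → ∀ u₀ : E3 → E3, IsDatum u₀ →
    ∀ (u u' : ℝ → E3 → E3) (p p' : ℝ → E3 → ℝ),
      IsSolutionOn ν (Ici 0) u₀ u p → IsSolutionOn ν (Ici 0) u₀ u' p' → ∀ t : ℝ, 0 ≤ t → u t = u' t

/-! ## C. The steps -/

/-- **Step 0 — local theory and blow-up alternative in `H¹`** (implicit; Thm 6.1 p.10 l.3–11 «There
exists NO finite time T* < ∞ such that lim_{t→T*} ‖u(t)‖_{H¹} = ∞ … Assume there exists T* < ∞ such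
that E(t) → ∞ as t → T*»; §5 Step 5 p.9 l.44–58), in the form the chain uses: from every datum EITHER a
global classical solution exists with `u(t) ∈ H¹`, `‖u(t)‖_{H¹}` and `E(t)` finite and `E` continuous on
`[0,∞)`, and `‖u(t)‖²_{H¹} ≤ ‖u(t)‖²_{L²} + 2E(t)`-type control — precisely: `H¹`-boundedness on every
`[0,T]` follows from a bound on `E` on `[0,T]` — OR there are `T* > 0` and a classical solution on
`[0,T*)` with `E` continuous on `[0,T*)` and unbounded there. Typist's flag: classical `H¹` theory
(Kato–Fujita; `‖∇u‖_{L²} = ‖ω‖_{L²}` for divergence-free fields and the energy inequality give the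
`H¹` control from `E`), implicit in the text, not a tree theorem at this grain.
[claim: Zeroual2026, status: disputed] [cite: Zeroual2026, Thm 6.1 p.10 l.2–25; §5 Step 5 p.9 l.44–58] -/
def Step0_LWP : Prop :=
  ∀ ν : ℝ, 0 < ν → ∀ u₀ : E3 → E3, IsDatum u₀ →
    (∃ (u : ℝ → E3 → E3) (p : ℝ → E3 → ℝ), IsSolutionOn ν (Ici 0) u₀ u p ∧
      (∀ t : ℝ, 0 ≤ t → InH1 (u t) ∧ (∫⁻ x, ‖curl (u t) x‖ₑ ^ 2) < ⊤) ∧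
      ContinuousOn (Ens u) (Ici 0) ∧
      ∀ T M : ℝ, 0 < T → (∀ t ∈ Icc 0 T, Ens u t ≤ M) → ∃ M' : ℝ, ∀ t ∈ Icc 0 T, h1Sq (u t) ≤ M') ∨
    ∃ Ts : ℝ, 0 < Ts ∧ ∃ (u : ℝ → E3 → E3) (p : ℝ → E3 → ℝ), IsSolutionOn ν (Ico 0 Ts) u₀ u p ∧
      ContinuousOn (Ens u) (Ico 0 Ts) ∧ (∀ t ∈ Ico 0 Ts, (∫⁻ x, ‖curl (u t) x‖ₑ ^ 2) < ⊤) ∧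
      ∀ M : ℝ, ∃ t ∈ Ico 0 Ts, M < Ens u t

/-- **Step 1 — Theorem 4.1 (Main Lemma) p.7 l.13–42 with Definition 2.4 (2.6) p.5 l.49–65**: «C*_L =
inf_{u ∈ D(A), u ≢ 0} ‖Au‖²_{L²}/‖u‖²_{L² log L} > 0 (4.1). The constant C*_L is independent of the
solution u.» Typed for the constant `K.Cstar`: it is a lower bound of the quotient over `D(A)` (the part
of «inf» the chain uses: `C*_L ‖u‖²_{L² log L} ≤ ‖Au‖²` for every `u ∈ D(A)`) AND it is positive. Printed
proof p.7 l.29–42 by Lemmas 3.1–3.3 p.6–7 (concentration-compactness for a minimizing sequence: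
weak `H²` limit, «vanishing cannot occur» by «Lions' lemma», dichotomy excluded by «strict
subadditivity», equi-integrability) — recorded here, not typed (the convergence mode in Lemma 3.1 (3)
is not printed); Remark 4.3 (4.2) p.8 l.2–10 «C*_L ≥ λ₁/C²_BGW > 0 where λ₁ > 0 is the spectral gap» —
recorded. Typist's flag: a scale-covariant quotient (dilation `u(x/λ)` multiplies `‖Δu‖²_{L²}` by `λ⁻¹`
and `‖u‖²_{L² log L}` by at least `λ³`) asserted to have a positive infimum — kernel-decidable for
every `K` with one explicit divergence-free `D(A)` field; predicted locator (CARD §4, sealed).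
[claim: Zeroual2026, status: disputed] [cite: Zeroual2026, Thm 4.1 (4.1) p.7 l.10–42; Def 2.4 (2.6) p.5 l.49–65] -/
def Step1_Thm41 (K : Constants) : Prop :=
  (∀ u : E3 → E3, InDA u → K.Cstar * olSq u ≤ stokesSq u) ∧ 0 < K.Cstar

/-- **Step 2 — (5.1) p.8 l.12–21** («Let E(t) = ½‖ω‖²_{L²}. From the vorticity equation: dE/dt +
ν‖Au‖²_{L²} ≤ |⟨(u·∇)u, Au⟩|»): along every classical solution on `[0,T)` from a datum, at every
`t ∈ (0,T)` where `E(t)`, `‖Δu(t)‖_{L²}` are finite, `E` is differentiable and the display holds (the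
pairing as the real `L²` inner product `∫⟪(u·∇)u, Δu⟫`). Printed SUPPORT of Step 5. Typist's flag:
TRUE-type (the classical enstrophy balance `½ d/dt‖∇u‖² + ν‖Δu‖² = ⟨(u·∇)u, Δu⟩` for decaying smooth
solutions), implicit decay hypotheses. [claim: Zeroual2026, status: disputed] [cite: Zeroual2026, (5.1) p.8 l.12–21] -/
def Step2_Eq51 : Prop :=
  ∀ ν : ℝ, 0 < ν → ∀ (T : ℝ) (u₀ : E3 → E3) (u : ℝ → E3 → E3) (p : ℝ → E3 → ℝ), IsDatum u₀ →
    IsSolutionOn ν (Ico 0 T) u₀ u p → ∀ t ∈ Ioo 0 T,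
      (∫⁻ x, ‖curl (u t) x‖ₑ ^ 2) < ⊤ → (∫⁻ x, ‖(Δ (u t)) x‖ₑ ^ 2) < ⊤ →
        DifferentiableAt ℝ (Ens u) t ∧
          deriv (Ens u) t + ν * stokesSq (u t) ≤ |∫ x, ⟪convect (u t) (u t) x, (Δ (u t)) x⟫_ℝ|

/-- **Step 3 — the «modified Brezis–Gallouet–Wainger inequality» (5.2) p.8 l.22–35**: «‖∇u‖_{L∞} ≤
C_BGW Ω_L √(log(e + ‖Au‖_{L²}/(Ω_L ‖u‖_{L²})))», for the fields of `D(A)` with `u ≢ 0` (function grain,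
as displayed: no solution is mentioned), `ν > 0`, `Ω_L = ν√C*_L`. Printed SUPPORT of Step 5 (via
(5.3)–(5.4)). Typist's flag: an amplitude-sensitive display (left side homogeneous of degree 1 in `u`,
right side of degree 0); support binder, unconsumed. [claim: Zeroual2026, status: disputed]
[cite: Zeroual2026, (5.2) p.8 l.22–35] -/
def Step3_BGW52 (K : Constants) : Prop :=
  ∀ ν : ℝ, 0 < ν → ∀ u : E3 → E3, InDA u → 0 < l2 u → (∃ B : ℝ, ∀ x, ‖fderiv ℝ u x‖ ≤ B) →
    ∀ x, ‖fderiv ℝ u x‖ ≤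
      K.CBGW * OmegaL K ν *
        Real.sqrt (Real.log (Real.exp 1 + Real.sqrt (stokesSq u) / (OmegaL K ν * l2 u)))

/-- **Step 4 — (5.3)–(5.4) p.8 l.36–40**: «|⟨(u·∇)u, Au⟩| ≤ ‖u‖_{L∞}‖∇u‖_{L²}‖Au‖_{L²} ≤ C Ω_L E^{1/2}
√(log(e + E)) ‖Au‖_{L²}», along every classical solution on `[0,T)` from a datum at times where the
norms are finite, with the constant `K.C54`. Printed SUPPORT of Step 5; unconsumed.
[claim: Zeroual2026, status: disputed] [cite: Zeroual2026, (5.3)–(5.4) p.8 l.36–40] -/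
def Step4_Eq54 (K : Constants) : Prop :=
  ∀ ν : ℝ, 0 < ν → ∀ (T : ℝ) (u₀ : E3 → E3) (u : ℝ → E3 → E3) (p : ℝ → E3 → ℝ), IsDatum u₀ →
    IsSolutionOn ν (Ico 0 T) u₀ u p → ∀ t ∈ Ioo 0 T,
      (∫⁻ x, ‖curl (u t) x‖ₑ ^ 2) < ⊤ → (∫⁻ x, ‖(Δ (u t)) x‖ₑ ^ 2) < ⊤ →
        |∫ x, ⟪convect (u t) (u t) x, (Δ (u t)) x⟫_ℝ| ≤
          K.C54 * OmegaL K ν * Real.sqrt (Ens u t) * Real.sqrt (Real.log (Real.exp 1 + Ens u t)) *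
            Real.sqrt (stokesSq (u t))

/-- **Step 5 — the enstrophy law (5.5)–(5.6) p.8 l.41–52 with (5.7), LOAD-BEARING**: «By Young's
inequality with ε = ν/2: |⟨(u·∇)u, Au⟩| ≤ (ν/2)‖Au‖²_{L²} + C′E log(e + E) (5.5). Therefore: dE/dt ≤
C′E log(e + E) (5.6)», `C′ = C_BGW · Ω_L = C_BGW · ν√C*_L` (5.7), used in Thm 6.1 p.10 l.12–15 «From
the enstrophy inequality (5.6)» along an arbitrary solution up to its putative blow-up time: along
every classical solution on `[0,T)` from a datum of the class, `E` is finite and continuous on `[0,T)`,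
differentiable on `(0,T)`, and `E′ ≤ C′E log(e + E)` there. Typist's flag: an a-priori enstrophy law
with a solution-independent constant — the Clay-strength display of the text; consumed (h5).
[claim: Zeroual2026, status: disputed] [cite: Zeroual2026, (5.5)–(5.7) p.8 l.41–68; Thm 6.1 p.10 l.12–15] -/
def Step5_Law56 (K : Constants) : Prop :=
  ∀ ν : ℝ, 0 < ν → ∀ (T : ℝ) (u₀ : E3 → E3) (u : ℝ → E3 → E3) (p : ℝ → E3 → ℝ), IsDatum u₀ →
    IsSolutionOn ν (Ico 0 T) u₀ u p →
      (∀ t ∈ Ico 0 T, (∫⁻ x, ‖curl (u t) x‖ₑ ^ 2) < ⊤) ∧ ContinuousOn (Ens u) (Ico 0 T) ∧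
        ∀ t ∈ Ioo 0 T, DifferentiableAt ℝ (Ens u) t ∧
          deriv (Ens u) t ≤ Cprime K ν * Ens u t * Real.log (Real.exp 1 + Ens u t)

/-- **Step 6 — Osgood control (5.8)–(5.9) p.9 l.16–28, (6.3) p.10 l.16–25**: «Since ∫_{E₀}^∞
dE/(C′E log(e+E)) = ∞ (Osgood integral diverges): E(t) ≤ F(T, E₀) < ∞ ∀ t ∈ [0,T] (5.8)», at the
function grain: for every rate `c > 0` there is a bound `F(T, y₀)` such that every non-negative `y`,
continuous on `[0,T)`, differentiable on `(0,T)` with `y′ ≤ c·y·log(e + y)` there, satisfies `y(t) ≤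
F(T, y(0))` on `[0,T)`. Typist's flag: TRUE-type (e.g. `F(T,y₀) = exp(log(e + y₀)·e^{cT})`, by Gronwall
on `log(e + y)`); consumed (h6). [claim: Zeroual2026, status: disputed]
[cite: Zeroual2026, (5.8)–(5.9) p.9 l.16–28; (6.3) p.10 l.16–25] -/
def Step6_Osgood : Prop :=
  ∀ c : ℝ, 0 < c → ∃ F : ℝ → ℝ → ℝ, ∀ (y : ℝ → ℝ) (T : ℝ), ContinuousOn y (Ico 0 T) →
    (∀ t ∈ Ico 0 T, 0 ≤ y t) →
    (∀ t ∈ Ioo 0 T, DifferentiableAt ℝ y t ∧ deriv y t ≤ c * y t * Real.log (Real.exp 1 + y t)) →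
    ∀ t ∈ Ico 0 T, y t ≤ F T (y 0)

/-- **Step 7 — §5 Step 5 (5.10)–(5.11) p.9 l.44–57**: «By Brezis–Gallouet–Wainger [4]: ‖ω‖_{L∞} ≤
C‖ω‖_{H¹} √(log(e + ‖ω‖_{H²}/‖ω‖_{H¹})) (5.10). Since E(t) is bounded: ∫₀ᵀ ‖ω‖_{L∞} dt < ∞ ∀ T < ∞
(5.11). By Beale–Kato–Majda [2], no finite-time singularity can form.» Typed as the display (5.10) at
the function grain for `C¹` vorticity fields with the printed norms finite and `‖ω‖_{H¹} > 0` (the `H¹`,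
`H²` norms of `ω` through `Dω`, `Δω` — classical grain), with the constant `K.CBGW`. SUPPORT, unconsumed
(the composition closes through the Thm 6.1 dichotomy of Step 0); typist's flag: the displayed
embedding is the two-dimensional Brezis–Gallouet form written in 3D. [claim: Zeroual2026, status: disputed]
[cite: Zeroual2026, (5.10)–(5.11) p.9 l.44–58] -/
def Step7_BGW510 (K : Constants) : Prop :=
  ∀ w : E3 → E3, ContDiff ℝ 2 w → (∫⁻ x, ‖w x‖ₑ ^ 2) < ⊤ → (∫⁻ x, ‖fderiv ℝ w x‖ₑ ^ 2) < ⊤ →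
    (∫⁻ x, ‖(Δ w) x‖ₑ ^ 2) < ⊤ → 0 < h1Sq w → (∃ B : ℝ, ∀ x, ‖w x‖ ≤ B) →
    ∀ x, ‖w x‖ ≤ K.CBGW * Real.sqrt (h1Sq w) *
      Real.sqrt (Real.log (Real.exp 1 + Real.sqrt (h1Sq w + stokesSq w) / Real.sqrt (h1Sq w)))

/-- **The energy inequality the text cites as Theorem 1.2 (Leray 1934) p.4 l.37–42** («weak solution
satisfying the energy inequality») together with Def 1.1 (4) p.4 l.30–33, in the form the Clay link
uses: along every global classical solution from a datum of the class, `∫|u(t)|² ≤ ∫|u₀|²` for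
`t ≥ 0`. Binder of the Clay link ONLY (it supplies Fefferman's (7)); typist's flag: TRUE-type for the
classical `H¹` solutions the claim produces (energy equality), wider than any tree theorem at the
printed grain (no decay class on `u`). [claim: Zeroual2026, status: disputed]
[cite: Zeroual2026, Thm 1.2 p.4 l.37–42; Def 1.1 (4) p.4 l.30–33] -/
def Step_Energy : Prop :=
  ∀ ν : ℝ, 0 < ν → ∀ (u₀ : E3 → E3) (u : ℝ → E3 → E3) (p : ℝ → E3 → ℝ), IsDatum u₀ →
    IsSolutionOn ν (Ici 0) u₀ u p → ∀ t : ℝ, 0 ≤ t → (∫⁻ x, ‖u t x‖ₑ ^ 2) ≤ ∫⁻ x, ‖u₀ x‖ₑ ^ 2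

/-- **The Clay delta Δ4 as an explicit hypothesis** (pattern C04b/C143/C152): Fefferman's data class (4)
— smooth, divergence-free, rapidly decaying with all derivatives — lies in `H¹(ℝ³)` (indeed in every
`H^s`). Classical; carried as a hypothesis of the Clay link, not asserted. [cite: FeffermanClay2006, (4) p.1]
[cite: BahouriCheminDanchin2011, §1.4.1] -/
def ClayDelta : Prop :=
  ∀ u₀ : E3 → E3, ContDiff ℝ ∞ u₀ → VectorCalculus.IsDivFree u₀ → HasRapidSpatialDecay u₀ → InH1 u₀

/-! ## D. Bookkeeping -/

/-- `l2Sq f ≥ 0`. [folklore] -/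
private theorem l2Sq_nonneg {F : Type*} [NormedAddCommGroup F] (f : E3 → F) : 0 ≤ l2Sq f :=
  ENNReal.toReal_nonneg

/-- `E(t) ≥ 0`. [folklore] -/
private theorem Ens_nonneg (u : ℝ → E3 → E3) (t : ℝ) : 0 ≤ Ens u t := by
  unfold Ens; have := l2Sq_nonneg (curl (u t)); positivity

/-- A global solution restricts to a solution on every `[0,T)`. [folklore] -/
private theorem IsSolutionOn.restrict {ν : ℝ} (T : ℝ) {u₀ : E3 → E3} {u : ℝ → E3 → E3}
    {p : ℝ → E3 → ℝ} (h : IsSolutionOn ν (Ici 0) u₀ u p) : IsSolutionOn ν (Ico 0 T) u₀ u p :=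
  ⟨h.isClassical.mono Ico_subset_Ici_self (uniqueDiffOn_Ico 0 T), h.initial⟩

/-- `C′ = C_BGW ν √C*_L > 0` when `ν > 0` and Thm 4.1 holds for `K`. [cite: Zeroual2026, (5.7) p.8 l.63–68] -/
theorem Cprime_pos (K : Constants) {ν : ℝ} (hν : 0 < ν) (h41 : Step1_Thm41 K) : 0 < Cprime K ν := by
  unfold Cprime OmegaL
  exact mul_pos K.CBGW_pos (mul_pos hν (Real.sqrt_pos.2 h41.2))

/-- The uniform reading of (1.5) implies the typed claim. [cite: Zeroual2026, Thm 1.4 (1.5) p.4 l.55–62] -/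
theorem claimed_of_uniform (h : ClaimedTheoremUniform) : ClaimedTheorem := by
  intro ν hν u₀ hd
  obtain ⟨u, p, hS, ⟨M, hM⟩, hE⟩ := h ν hν u₀ hd
  exact ⟨u, p, hS, fun T _ => ⟨M, fun t ht => hM t ht.1⟩, hE⟩

/-! ## E. Kernel composition -/

/-- Along a solution on `[0,T)` from a datum, Steps 5–6 bound `E` on `[0,T)` by `F(T, E(0))` for the
Osgood bound `F` of the rate `C′`. [cite: Zeroual2026, §5 Steps 3–4 p.8–9; Thm 6.1 p.10] -/
theorem Ens_le_of_steps (K : Constants) {ν : ℝ} (hν : 0 < ν) (h5 : Step5_Law56 K) {F : ℝ → ℝ → ℝ}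
    (hF : ∀ (y : ℝ → ℝ) (T : ℝ), ContinuousOn y (Ico 0 T) → (∀ t ∈ Ico 0 T, 0 ≤ y t) →
      (∀ t ∈ Ioo 0 T, DifferentiableAt ℝ y t ∧
        deriv y t ≤ Cprime K ν * y t * Real.log (Real.exp 1 + y t)) →
      ∀ t ∈ Ico 0 T, y t ≤ F T (y 0))
    {T : ℝ} {u₀ : E3 → E3} {u : ℝ → E3 → E3} {p : ℝ → E3 → ℝ} (hd : IsDatum u₀)
    (hS : IsSolutionOn ν (Ico 0 T) u₀ u p) : ∀ t ∈ Ico 0 T, Ens u t ≤ F T (Ens u 0) := by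
  obtain ⟨-, hcont, hlaw⟩ := h5 ν hν T u₀ u p hd hS
  exact hF (Ens u) T hcont (fun t _ => Ens_nonneg u t) hlaw

/-- **COMPOSITION** — Steps 0, 1, 5, 6 (with Steps 2–4 the printed support of Step 5 and Step 7 the
printed BKM route, unconsumed) imply the claimed statement, for any choice of the printed constants `K`:
Thm 4.1 makes `C′ > 0`, Osgood (Step 6) gives the bound `F`; Step 0 splits — in the global branch Steps
5–6 bound `E` on every `[0,T+1)`, whence the `H¹` bound on `[0,T]` by Step 0's control clause; in the
blow-up branch the same bound on `[0,T*)` contradicts the unboundedness of `E` (Thm 6.1).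
[cite: Zeroual2026, §5 pp.8–9; Thm 6.1 p.10; §8 p.11] -/
theorem claim_of_steps (K : Constants) (h0 : Step0_LWP) (h1 : Step1_Thm41 K) (_h2 : Step2_Eq51)
    (_h3 : Step3_BGW52 K) (_h4 : Step4_Eq54 K) (h5 : Step5_Law56 K) (h6 : Step6_Osgood)
    (_h7 : Step7_BGW510 K) : ClaimedTheorem := by
  intro ν hν u₀ hd
  obtain ⟨F, hF⟩ := h6 (Cprime K ν) (Cprime_pos K hν h1)
  rcases h0 ν hν u₀ hd with ⟨u, p, hG, hfin, _hcont, hctrl⟩ | ⟨Ts, _hTs, u, p, hL, _hc, _hf, hunb⟩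
  · refine ⟨u, p, hG, fun T hT => ?_, fun t ht => (hfin t ht).2⟩
    -- `E ≤ F(T+1, E(0))` on `[0,T]`, then Step 0's control clause gives the `H¹` bound
    have hb : ∀ t ∈ Icc 0 T, Ens u t ≤ F (T + 1) (Ens u 0) := fun t ht =>
      Ens_le_of_steps K hν h5 hF hd (hG.restrict (T + 1)) t ⟨ht.1, by linarith [ht.2]⟩
    obtain ⟨M', hM'⟩ := hctrl T (F (T + 1) (Ens u 0)) hT hb
    exact ⟨M', fun t ht => ⟨(hfin t ht.1).1, hM' t ht⟩⟩
  · exfalso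
    obtain ⟨t, ht, hMt⟩ := hunb (F Ts (Ens u 0))
    exact absurd hMt (not_lt.mpr (Ens_le_of_steps K hν h5 hF hd hL t ht))

/-! ## F. The Clay link -/

/-- **Clay link** — the claimed statement (global classical solutions for the WIDER printed class), the
energy inequality the text cites (Thm 1.2; `Step_Energy`, supplying Fefferman's (7)) and the data
inclusion `ClayDelta` (Δ4) give Clay (A) (`ClayVariants.clayR3.Regularity`).
[cite: FeffermanClay2006, (A) with (1)–(4), (6), (7) pp.1–2] [cite: Zeroual2026, Thm 1.4 p.4 l.50–62; Thm 1.2 p.4 l.37–42] -/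
theorem clay_of_claimed (h : ClaimedTheorem) (hE : Step_Energy) (hΔ : ClayDelta) :
    ClayVariants.clayR3.Regularity := by
  intro ν hν u₀ hsm hdiv hdec
  have hd : IsDatum u₀ := ⟨hsm, hdiv, hΔ u₀ hsm hdiv hdec⟩
  obtain ⟨u, p, hG, -, -⟩ := h ν hν u₀ hd
  obtain ⟨hns, hsu, hsp⟩ :=
    (isNavierStokesSolution_and_smooth_iff (ν := ν) (f := 0) (u₀ := u₀) (u := u) (p := p)).2
      ⟨hG.isClassical, hG.initial⟩
  refine ⟨u, p, hsu, hsp, hns, ?_⟩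
  show HasBoundedEnergy u
  exact ⟨∫⁻ x, ‖u₀ x‖ₑ ^ 2, hd.2.2.1, fun t ht => hE ν hν u₀ u p hd hG t ht⟩

end

end Literature.Claims.NS.Zeroual2026

-- WHAT THIS IS NOT: not a claim about NS regularity or blow-up; not a claim about any author beyond
-- the typed locator.

/-! ## G. Discharges (rev 2, append-only) — Step 6 (Osgood control (5.8)) holds

The TRUE-type Step 6 is proved at the typed function grain: Gronwall applied to `w = log(e + y)`.
Nothing keyed to a locator; no new `def … : Prop`. -/

namespace Literature.Claims.NS.Zeroual2026

open _root_.Set _root_.Filter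
open scoped Topology

noncomputable section

/-- Gronwall for a one-sided differential inequality `w′ ≤ c·w` on `(0,T)` with `w` continuous on
`[0,T)`: `w t ≤ w 0 · exp(c·T)` for `t ∈ [0,T)` when `c ≥ 0` and `w ≥ 0`. [folklore] -/
private theorem gronwall_Ico {w : ℝ → ℝ} {c T : ℝ} (hc : 0 ≤ c) (hw : ContinuousOn w (Ico 0 T))
    (hw0 : ∀ s ∈ Ico 0 T, 0 ≤ w s)
    (hd : ∀ s ∈ Ioo 0 T, ∃ w' : ℝ, HasDerivAt w w' s ∧ w' ≤ c * w s) :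
    ∀ t ∈ Ico 0 T, w t ≤ w 0 * Real.exp (c * T) := by
  intro t ht
  have hT : 0 < T := lt_of_le_of_lt ht.1 ht.2
  rcases eq_or_lt_of_le ht.1 with h0 | htpos
  · -- `t = 0`
    subst h0
    have h1 : (1 : ℝ) ≤ Real.exp (c * T) := Real.one_le_exp (mul_nonneg hc hT.le)
    nlinarith [hw0 0 ht]
  -- Gronwall on `[s₀, t]` for `0 < s₀ ≤ t`, then `s₀ → 0⁺`
  have key : ∀ s₀ ∈ Ioo 0 t, w t ≤ w s₀ * Real.exp (c * T) := by
    intro s₀ hs₀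
    have hsub : Icc s₀ t ⊆ Ico 0 T := fun x hx => ⟨hs₀.1.le.trans hx.1, lt_of_le_of_lt hx.2 ht.2⟩
    choose! w' hw' using hd
    have hG := le_gronwallBound_of_liminf_deriv_right_le (f := w) (f' := w') (δ := w s₀) (K := c)
      (ε := 0) (a := s₀) (b := t) (hw.mono hsub) ?_ le_rfl ?_
    · have := hG t ⟨hs₀.2.le, le_rfl⟩
      rw [gronwallBound_ε0] at this
      refine this.trans ?_
      have hws : 0 ≤ w s₀ := hw0 s₀ (hsub ⟨le_rfl, hs₀.2.le⟩)
      exact mul_le_mul_of_nonneg_left (Real.exp_le_exp.2 (by nlinarith [hs₀.1, ht.2])) hws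
    · intro x hx r hr
      have hxI : x ∈ Ioo 0 T := ⟨hs₀.1.trans_le hx.1, lt_trans (lt_of_lt_of_le hx.2 le_rfl) ht.2⟩
      have hder : HasDerivWithinAt w (w' x) (Ici x) x := (hw' x hxI).1.hasDerivWithinAt
      exact (hder.liminf_right_slope_le hr).mono fun z hz => by
        simpa only [slope, vsub_eq_sub, smul_eq_mul] using hz
    · intro x hx
      have hxI : x ∈ Ioo 0 T := ⟨hs₀.1.trans_le hx.1, lt_trans hx.2 ht.2⟩
      simpa using (hw' x hxI).2
  -- pass to the limit `s₀ → 0⁺`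
  have hmem : Ico 0 T ∈ 𝓝[>] (0 : ℝ) :=
    mem_of_superset (Ioo_mem_nhdsGT hT) Ioo_subset_Ico_self
  have hlim : Tendsto (fun s₀ => w s₀ * Real.exp (c * T)) (𝓝[>] (0 : ℝ))
      (𝓝 (w 0 * Real.exp (c * T))) := by
    have h0 : ContinuousWithinAt w (Ico 0 T) 0 := hw 0 ⟨le_rfl, hT⟩
    exact (h0.tendsto.mono_left (nhdsWithin_le_of_mem hmem)).mul_const _
  refine ge_of_tendsto hlim ?_
  filter_upwards [Ioo_mem_nhdsGT htpos] with s₀ hs₀ using key s₀ hs₀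

/-- **Step 6 holds** — the Osgood/Gronwall bound (5.8): with `F(T, y₀) = exp(log(e + y₀)·e^{cT})`,
every non-negative `y`, continuous on `[0,T)` and differentiable on `(0,T)` with `y′ ≤ c·y·log(e + y)`,
satisfies `y(t) ≤ F(T, y(0))` on `[0,T)` (apply Gronwall to `w = log(e + y)`, whose derivative is
`y′/(e + y) ≤ c·log(e + y)`). [cite: Zeroual2026, (5.8)–(5.9) p.9 l.16–28; (6.3) p.10 l.16–25] -/
theorem step6_holds : Step6_Osgood := by
  intro c hc
  refine ⟨fun T y₀ => Real.exp (Real.log (Real.exp 1 + y₀) * Real.exp (c * T)), ?_⟩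
  intro y T hcont hnn hdiff t ht
  have he : 0 < Real.exp 1 := Real.exp_pos 1
  -- `w = log(e + y)`
  set w : ℝ → ℝ := fun s => Real.log (Real.exp 1 + y s) with hw_def
  have hpos : ∀ s ∈ Ico 0 T, 0 < Real.exp 1 + y s := fun s hs => by linarith [hnn s hs]
  have hw_cont : ContinuousOn w (Ico 0 T) :=
    (continuousOn_const.add hcont).log fun s hs => (hpos s hs).ne'
  have hw_nn : ∀ s ∈ Ico 0 T, 0 ≤ w s := fun s hs =>
    Real.log_nonneg (by linarith [hnn s hs, Real.add_one_le_exp (1 : ℝ)])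
  have hw_d : ∀ s ∈ Ioo 0 T, ∃ w' : ℝ, HasDerivAt w w' s ∧ w' ≤ c * w s := by
    intro s hs
    have hsI : s ∈ Ico 0 T := ⟨hs.1.le, hs.2⟩
    obtain ⟨hds, hle⟩ := hdiff s hs
    have hys : 0 ≤ y s := hnn s hsI
    have hp := hpos s hsI
    refine ⟨deriv y s / (Real.exp 1 + y s), (hds.hasDerivAt.const_add (Real.exp 1)).log hp.ne', ?_⟩
    have hL : 0 ≤ Real.log (Real.exp 1 + y s) := hw_nn s hsI
    rw [div_le_iff₀ hp]
    calc deriv y s ≤ c * y s * Real.log (Real.exp 1 + y s) := hle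
      _ ≤ c * (Real.exp 1 + y s) * Real.log (Real.exp 1 + y s) := by
          have : c * y s ≤ c * (Real.exp 1 + y s) := by nlinarith
          exact mul_le_mul_of_nonneg_right this hL
      _ = c * w s * (Real.exp 1 + y s) := by simp only [hw_def]; ring
  have hG := gronwall_Ico hc.le hw_cont hw_nn hw_d t ht
  -- back to `y`
  have hyt : y t = Real.exp (w t) - Real.exp 1 := by
    simp only [hw_def]; rw [Real.exp_log (hpos t ht)]; ring
  rw [hyt]
  have : Real.exp (w t) ≤ Real.exp (w 0 * Real.exp (c * T)) := Real.exp_le_exp.2 hG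
  linarith

end

end Literature.Claims.NS.Zeroual2026

-- WHAT THIS IS NOT: not a claim about NS regularity or blow-up; not a claim about any author beyond
-- the typed locator.

/-! ## H. The Clay delta discharged (rev 3, append-only; keeper ns-claims-lit-4, CLAY-LINK C157)

`ClayDelta` (Δ4) is proved and the Clay link restated without it. Nothing keyed to a locator; no new
`def … : Prop`; l.1–536 untouched. -/

namespace Literature.Claims.NS.Zeroual2026

open Literature.Analysis.FluidPDE
open _root_.MeasureTheory
open scoped ContDiff ENNReal

noncomputable section

/-- **The Clay delta `ClayDelta` HOLDS**: every smooth divergence-free field of Fefferman's class (4) lies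
in `H¹(ℝ³)` in the file's sense (`∫‖u₀‖² < ∞` and `∫‖Du₀‖² < ∞`) — `Dⁿu₀ ∈ L²` for every `n` by the decay
(tree `HasRapidSpatialDecay.lintegral_enorm_iteratedFDeriv_sq_lt_top`, at `n = 0` and `n = 1`, with
`‖D⁰u₀(x)‖ = ‖u₀(x)‖`, `‖D¹u₀(x)‖ = ‖Du₀(x)‖`). [folklore] [cite: FeffermanClay2006, (4) p.1]
[cite: BahouriCheminDanchin2011, §1.4.1] -/
theorem clayDelta_holds : ClayDelta := by
  intro u₀ hs _hdiv hdec
  have h0 := hdec.lintegral_enorm_iteratedFDeriv_sq_lt_top (μ := (volume : Measure E3)) 0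
  have h1 := hdec.lintegral_enorm_iteratedFDeriv_sq_lt_top (μ := (volume : Measure E3)) 1
  have heq0 : (fun x => ‖iteratedFDeriv ℝ 0 u₀ x‖ₑ ^ 2) = fun x => ‖u₀ x‖ₑ ^ 2 := by
    funext x
    rw [← ofReal_norm, ← ofReal_norm, norm_iteratedFDeriv_zero]
  have heq1 : (fun x => ‖iteratedFDeriv ℝ 1 u₀ x‖ₑ ^ 2) = fun x => ‖fderiv ℝ u₀ x‖ₑ ^ 2 := by
    funext x
    rw [← ofReal_norm, ← ofReal_norm, ← norm_iteratedFDeriv_fderiv, norm_iteratedFDeriv_zero]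
  rw [heq0] at h0
  rw [heq1] at h1
  exact ⟨h0, h1⟩

/-- **Clay link with the Δ4 binder discharged**: the claimed statement (global classical solutions for the
wider printed class) and the cited energy inequality (Thm 1.2, `Step_Energy`, supplying Fefferman's (7))
give Clay (A); the remaining extra binder is the paper's own step, not a Clay-axis delta.
[cite: FeffermanClay2006, (A) with (1)–(4), (6), (7) pp.1–2] [cite: Zeroual2026, Thm 1.4 p.4 l.50–62; Thm 1.2 p.4 l.37–42] -/
theorem clay_of_claimed' (h : ClaimedTheorem) (hE : Step_Energy) : ClayVariants.clayR3.Regularity :=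
  clay_of_claimed h hE clayDelta_holds

end

end Literature.Claims.NS.Zeroual2026

-- WHAT THIS IS NOT: not a claim about NS regularity or blow-up; not a claim about any author beyond
-- the typed locator.

/-! ## I. The Clay link, binder-free (rev 4, append-only; keeper ns-claims-lit-4, CLAY-LINK C157)

The claimed sentence's own clause «`u ∈ L^∞([0,T]; H¹(ℝ³))` on every `[0,T]`» bounds the energy on every
compact slab, so Leray's energy inequality for finite-energy classical solutions (tree door
`ClayVariants.clayR3_solvable_of_classical_slabBoundedEnergy`) supplies Fefferman's (7): neither the cited
energy inequality `Step_Energy` nor the data delta is needed. Nothing keyed to a locator; no new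
`def … : Prop`; one new `import`; earlier lines untouched. -/

namespace Literature.Claims.NS.Zeroual2026

open Literature.Analysis.FluidPDE
open _root_.MeasureTheory _root_.Set
open scoped ContDiff ENNReal

noncomputable section

/-- **Clay link, binder-free: `ClaimedTheorem → (A)`.** For a Clay datum (class (4), hence `IsDatum` by
`clayDelta_holds`) the claimed global solution carries, on every `[0, T]`, the bound
`‖u(t)‖²_{L²} + ‖Du(t)‖²_{L²} ≤ M` (the typed «`u ∈ L^∞([0,T]; H¹)`»), in particular a per-slab energy
bound; the tree's door `clayR3_solvable_of_classical_slabBoundedEnergy` (Leray's energy inequality for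
finite-energy classical solutions) turns it into Fefferman's (6)–(7).
[cite: Zeroual2026, Thm 1.4 (1.5) p.4 l.50–62] [cite: FeffermanClay2006, (A) with (4), (6), (7) pp.1–2]
[cite: Leray1934, §17 (3.4) p. 220] -/
theorem clayA_of_claimed (h : ClaimedTheorem) : ClayVariants.clayR3.Regularity := by
  intro ν hν u₀ hsm hdiv hdec
  have hd : IsDatum u₀ := ⟨hsm, hdiv, clayDelta_holds u₀ hsm hdiv hdec⟩
  obtain ⟨u, p, hG, hH1, -⟩ := h ν hν u₀ hd
  refine ClayVariants.clayR3_solvable_of_classical_slabBoundedEnergy hν hd.2.2.1 hG.isClassical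
    hG.initial fun T hT => ?_
  obtain ⟨M, hM⟩ := hH1 T hT
  refine ⟨ENNReal.ofReal M, ENNReal.ofReal_lt_top, fun t ht => ?_⟩
  obtain ⟨hfin, hle⟩ := hM t ht
  rw [← ENNReal.ofReal_toReal hfin.1.ne]
  refine ENNReal.ofReal_le_ofReal ?_
  have h2 : 0 ≤ l2Sq (fderiv ℝ (u t)) := ENNReal.toReal_nonneg
  have h3 : l2Sq (u t) + l2Sq (fderiv ℝ (u t)) ≤ M := hle
  show (∫⁻ x, ‖u t x‖ₑ ^ 2).toReal ≤ M
  have : l2Sq (u t) = (∫⁻ x, ‖u t x‖ₑ ^ 2).toReal := rfl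
  linarith

end

end Literature.Claims.NS.Zeroual2026

-- WHAT THIS IS NOT: not a claim about NS regularity or blow-up; not a claim about any author beyond
-- the typed locator.
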